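import Summits.CriticalPhenomena.PercolationContinuityZ3.Theorems.PercNearOneGluingNoHeavyLowerTailQ44TerminalPairHalves
import HarnessLib

/-!
# The darts-only packing `D_U`: its terminal-pair pencils at `ab` and `cy` have nonnegative mixed term (all `n`)

Support file for crux `stmt-CriticalPhenomena-4575` (master-family programme; the complementary-packing rows `U ≥ 0`, `D_U ≥ 0` of
`prim-bnk-1` gen 34–37, both OPEN for all `n`; `…Q44AbstractCountSockets`, `…Q44PackUPencilSocket`), seat `prim-l12-p6` gen 30; memo
`run/shared/lean/prim/prim-l12/FROM-prim-l12-p6-g30-MONOTONE-HALL.md` §1b (addendum).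

`D_U = 2c₀c₁₄ − (c₂c₁₀ + c₂c₁₃ + c₃c₁₀ + c₃c₁₂ + c₄c₇ + c₄c₁₃ + c₅c₇ + c₅c₁₂)` (cells of `FourPointAtoms.pat4`).  Along the pencil of a
terminal–terminal pair `e = ab` of weight `t`, `D_U(w) = (1−t)²·D_U(w[e↦0]) + 2t(1−t)·MIX + t²·0` (the contracted law has `a = b`, where every cell
of `D_U` vanishes), and `2·MIX = Σ_{i,j} K(i ∨ ab, j)·cᵢcⱼ` in the cells of `w[e↦0]` with `K` the symmetric kernel of `D_U`.  The anchored kernel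
`(i,j) ↦ K(i ∨ ab, j)` has goods `{bcy, ay|bc, ac|by, acy, abcy} × {⊥}` (weight 2) and the twelve bad types
`{by, ay, aby} × {bc, ac} ∪ {bc, ac, abc} × {by, ay}`, which split into two Marica–Schönheim-valid packings (`prim-l12-p6` gen 30, found
by the bipartiteness test of code-gen30/py/ttsplit.py); `ConjWHalves.sum_cells_le_of_two_packings` then gives, on EVERY finite weighted graph:

* `DartsTerminalPair.mix_ab`: `(c₂+c₄+c₁₂)(c₃+c₅) + (c₃+c₅+c₁₃)(c₂+c₄) ≤ 2c₀(c₇+c₈+c₉+c₁₀+c₁₄)`  (`mix_ab_expanded` written out),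
* `DartsTerminalPair.mix_cy`: `(c₂+c₃+c₇)(c₄+c₅) + (c₄+c₅+c₁₀)(c₂+c₃) ≤ 2c₀(c₈+c₉+c₁₂+c₁₃+c₁₄)`  (`mix_cy_expanded`).

Consequence (read with `…Q44PackUPencilSocket.law_oneBond`-type pencil identities, not restated here): `D_U(G) ≥ (1−t_{ab})²·D_U(G ∖ ab)` and
likewise for `cy` — a minimal counterexample to `D_U ≥ 0` has no `ab` and no `cy` edge.  For the pairs `ac, by, ay, bc` (which carry the darts)
and for the kernels `U`, `S3`, `W` no MS 2-split of the anchored types exists (memo).  Note (ttrl3 relay 329, 2026-08-25): the full pencil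
CONCAVITY `PC_DU` is false, `MIX ≥ 0` stands in 2.23·10⁹ pencils; this file proves `MIX ≥ 0` at the two dart-free terminal pairs.
Pure finite combinatorics; no definitions, no named facts, no sorries, standard axioms.
-/

namespace Summit.CriticalPhenomena.PercolationContinuityZ3.Theorems

namespace DartsTerminalPair

open Finset TwoCopyMono FourPointAtoms ConjWHalves

variable {n : ℕ}

/-- **Mixed term of the `D_U`-pencil at the pair `ab`**: types `{by, ay, aby} × {bc, ac}` and `{bc, ac, abc} × {by, ay}` against the goods
`{bcy, ay|bc, ac|by, acy, abcy} × {⊥}` (two MS packings, table checks by `decide`). [this work] -/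
theorem mix_ab (w : Sym2 (Fin n) → unitInterval) (a b c y : Fin n) :
    (∑ p ∈ ({2, 4, 12} : Finset (Fin 15)) ×ˢ ({3, 5} : Finset (Fin 15)), cell w a b c y p.1 * cell w a b c y p.2) +
        (∑ p ∈ ({3, 5, 13} : Finset (Fin 15)) ×ˢ ({2, 4} : Finset (Fin 15)), cell w a b c y p.1 * cell w a b c y p.2) ≤
      2 * ∑ p ∈ ({7, 8, 9, 10, 14} : Finset (Fin 15)) ×ˢ ({0} : Finset (Fin 15)), cell w a b c y p.1 * cell w a b c y p.2 :=
  sum_cells_le_of_two_packings (by decide +kernel) (by decide +kernel) w a b c y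

/-- **Mixed term of the `D_U`-pencil at the pair `cy`** (the `(ab)(cy)… V₄`-image: types `{by, bc, bcy} × {ay, ac}` and
`{ay, ac, acy} × {by, bc}` against `{ay|bc, ac|by, aby, abc, abcy} × {⊥}`). [this work] -/
theorem mix_cy (w : Sym2 (Fin n) → unitInterval) (a b c y : Fin n) :
    (∑ p ∈ ({2, 3, 7} : Finset (Fin 15)) ×ˢ ({4, 5} : Finset (Fin 15)), cell w a b c y p.1 * cell w a b c y p.2) +
        (∑ p ∈ ({4, 5, 10} : Finset (Fin 15)) ×ˢ ({2, 3} : Finset (Fin 15)), cell w a b c y p.1 * cell w a b c y p.2) ≤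
      2 * ∑ p ∈ ({8, 9, 12, 13, 14} : Finset (Fin 15)) ×ˢ ({0} : Finset (Fin 15)), cell w a b c y p.1 * cell w a b c y p.2 :=
  sum_cells_le_of_two_packings (by decide +kernel) (by decide +kernel) w a b c y

/-- `mix_ab` written out: `(c₂+c₄+c₁₂)(c₃+c₅) + (c₃+c₅+c₁₃)(c₂+c₄) ≤ 2c₀(c₇+c₈+c₉+c₁₀+c₁₄)` on every finite weighted graph. [this work] -/
theorem mix_ab_expanded (w : Sym2 (Fin n) → unitInterval) (a b c y : Fin n) :
    (cell w a b c y 2 + cell w a b c y 4 + cell w a b c y 12) * (cell w a b c y 3 + cell w a b c y 5) +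
        (cell w a b c y 3 + cell w a b c y 5 + cell w a b c y 13) * (cell w a b c y 2 + cell w a b c y 4) ≤
      2 * cell w a b c y 0 * (cell w a b c y 7 + cell w a b c y 8 + cell w a b c y 9 + cell w a b c y 10 + cell w a b c y 14) := by
  have h := mix_ab w a b c y
  simp only [Finset.sum_product, Finset.sum_insert, Finset.mem_insert, Finset.mem_singleton, Finset.sum_singleton,
    Fin.reduceEq, or_self, not_false_eq_true] at h
  nlinarith [h]

/-- `mix_cy` written out: `(c₂+c₃+c₇)(c₄+c₅) + (c₄+c₅+c₁₀)(c₂+c₃) ≤ 2c₀(c₈+c₉+c₁₂+c₁₃+c₁₄)` on every finite weighted graph. [this work] -/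
theorem mix_cy_expanded (w : Sym2 (Fin n) → unitInterval) (a b c y : Fin n) :
    (cell w a b c y 2 + cell w a b c y 3 + cell w a b c y 7) * (cell w a b c y 4 + cell w a b c y 5) +
        (cell w a b c y 4 + cell w a b c y 5 + cell w a b c y 10) * (cell w a b c y 2 + cell w a b c y 3) ≤
      2 * cell w a b c y 0 * (cell w a b c y 8 + cell w a b c y 9 + cell w a b c y 12 + cell w a b c y 13 + cell w a b c y 14) := by
  have h := mix_cy w a b c y
  simp only [Finset.sum_product, Finset.sum_insert, Finset.mem_insert, Finset.mem_singleton, Finset.sum_singleton,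
    Fin.reduceEq, or_self, not_false_eq_true] at h
  nlinarith [h]

end DartsTerminalPair

end Summit.CriticalPhenomena.PercolationContinuityZ3.Theorems
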